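import Mathlib
import HarnessLib
import Summits.HubbardSuperconductivity.HubbardSuperconductivity.Theorems.KLProgrammeKLRegimeEngineIsoResectorisation

/-!
# Route `KLProgramme` — ENGINE item stmt-HubbardSuperconductivity-20437, class #6 / (E5-F)ₙ producer, route (M) of the (α-0) scoping memo
# (p1b g11, evidence on 20437): the NEAR/FAR split of the fixed-tuple size — `fixedTupleL1 ≤ ε^m·N_R^m·sup|W| + m·M₁/R` — and the sup of a
# sectorised kernel by its momentum data (the combinatorial skeleton of (V1′); the two model numbers `N_R`, `Σ_k ∏|F|·|ker|` are left to M1)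

Cell gate-hubbard-kl, seat hubbard-kl-k3c2-p2 (g10; class-#6 owner, bidder for M1 + M3 of route (M)).  Route (M) («values + per-tuple FIRST MOMENTS ⇒ per-tuple L¹»,
ALPHA0-SCOPING-MEMO §2.1) bounds the class-#6 size `fixedTupleL1 β 3 (klIsoKernelAt … K_n n m) Ω x₁` by a NEAR part (the tuples whose free legs all sit within space-time
distance `R` of the pinned leg: their number times the sup of the kernel, and the sup by the kernel's momentum data — ultimately (E5-F)'s value hypothesis `B`) plus a FAR part
(first moment over `R`, an irrelevant datum the tower can export per tuple, (E4-iso)ₙ).  This file is the model-free skeleton of that inequality in the cell's conventions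
(`fixedTupleL1`, `imagTimeWeight`, `spaceTimeDist`, `sectorisedKernel`):

* §1 `sum_norm_le_near_add_far` — for a finite sum: `Σ_{x∈s}‖w x‖ ≤ #(s ∩ {r < R})·B + R⁻¹·Σ_{x∈s} r(x)‖w x‖` (`‖w‖ ≤ B` on `s`, `r ≥ 0`, `R > 0`);
* §2 `card_filter_forall_le_pow` — tuples all of whose entries pass a test: `#{x : Fin m → α | ∀ i, p (x i)} ≤ (#{y | p y})^m`;
* §3 **`fixedTupleL1_le_near_add_far`** — for ANY kernel family `W`, tuple `Ω`, pinned point `x₁`, radius `R > 0`: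
  `fixedTupleL1 β m W Ω x₁ ≤ ε^m·N_R^m·B + m·Mom/R`, where `B` bounds `‖W_Ω(x₁ :: x)‖`, `Mom` bounds each of the `m` first moments
  `ε^m·Σ_x spaceTimeDist(x₁, x_i)·‖W_Ω(x₁ :: x)‖` (the (E4)/`EngineFirstMoments` currency, leg `0` pinned), and `N_R ≥ #{y : spaceTimeDist(x₁, y) < R}` (the near count per leg);
* §4 **`fixedTupleL1_sectorisedKernel_le_near_add_far`** — §3 with the x-INDEPENDENT sup `‖W_{F,Ω}(x)‖ ≤ Σ_k (∏_i ‖F_{Ω_i}(k_i)‖)·‖kernel G m k‖`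
  (`Literature…SectorisedKernelNorm.norm_sectorisedKernel_le`): the near part reads only the multipliers' momentum masses and the kernel's momentum VALUES.

What M1 of route (M) still owes (not here): the near count `N_R` of the iso(m) dual box (`#near × vol(supp F̂) = O(ρ)` per leg and direction) and the momentum mass
`Σ_k ∏‖F_{Ω_i}(k_i)‖·‖ker‖ ≤ vol(supp)·sup_{box}|ker|` with the box–ball comparison of (E5-F)'s hypothesis; what M2 owes: the per-iso-tuple first moment (E4-iso)ₙ.
Everything is proved; no definitions; nothing about the model is asserted beyond these implications.
-/

noncomputable section

namespace Summit.HubbardSuperconductivity.HubbardSuperconductivity.Theorems.EngineV8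

set_option linter.dupNamespace false -- summit = problem name (single-conjunct summit), D-0017

open Classical
open Real Finset Literature.MathematicalPhysics.QuantumLattice Literature.Probability.LatticeModels GrassmannAlgebra
open Summit.HubbardSuperconductivity.HubbardSuperconductivity.Theorems.KLProgrammeLegKernels
open Summit.HubbardSuperconductivity.HubbardSuperconductivity.Theorems.KLRegimeSplit

/-! ## §1 The near/far split of a finite sum -/

/-- **Near/far**: for a finite sum of norms with a nonnegative «radius» `r`, a threshold `R > 0` and a uniform bound `‖w x‖ ≤ B` on `s`:
`Σ_{x∈s}‖w x‖ ≤ #(s.filter (r · < R))·B + R⁻¹·Σ_{x∈s} r x·‖w x‖` (near terms by the sup, far terms by `1 ≤ r(x)/R`). -/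
theorem sum_norm_le_near_add_far {α E : Type*} [SeminormedAddCommGroup E] (s : Finset α) (w : α → E) (r : α → ℝ) (hr : ∀ x ∈ s, 0 ≤ r x)
    {R B : ℝ} (hR : 0 < R) (hB : ∀ x ∈ s, ‖w x‖ ≤ B) :
    ∑ x ∈ s, ‖w x‖ ≤ ((s.filter fun x => r x < R).card : ℝ) * B + R⁻¹ * ∑ x ∈ s, r x * ‖w x‖ := by
  rw [← sum_filter_add_sum_filter_not s (fun x => r x < R)]
  have hnear : ∑ x ∈ s.filter (fun x => r x < R), ‖w x‖ ≤ ((s.filter fun x => r x < R).card : ℝ) * B := by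
    calc ∑ x ∈ s.filter (fun x => r x < R), ‖w x‖ ≤ ∑ _x ∈ s.filter (fun x => r x < R), B :=
          sum_le_sum fun x hx => hB x (mem_filter.1 hx).1
      _ = ((s.filter fun x => r x < R).card : ℝ) * B := by rw [sum_const, nsmul_eq_mul]
  have hfar : ∑ x ∈ s.filter (fun x => ¬ r x < R), ‖w x‖ ≤ R⁻¹ * ∑ x ∈ s, r x * ‖w x‖ := by
    calc ∑ x ∈ s.filter (fun x => ¬ r x < R), ‖w x‖ ≤ ∑ x ∈ s.filter (fun x => ¬ r x < R), R⁻¹ * (r x * ‖w x‖) := by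
          refine sum_le_sum fun x hx => ?_
          have hRx : R ≤ r x := not_lt.1 (mem_filter.1 hx).2
          have h1 : 1 ≤ R⁻¹ * r x := by rw [le_inv_mul_iff₀ hR]; simpa using hRx
          calc ‖w x‖ = 1 * ‖w x‖ := (one_mul _).symm
            _ ≤ R⁻¹ * r x * ‖w x‖ := mul_le_mul_of_nonneg_right h1 (norm_nonneg _)
            _ = R⁻¹ * (r x * ‖w x‖) := by ring
      _ = R⁻¹ * ∑ x ∈ s.filter (fun x => ¬ r x < R), r x * ‖w x‖ := by rw [mul_sum]
      _ ≤ R⁻¹ * ∑ x ∈ s, r x * ‖w x‖ := by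
          refine mul_le_mul_of_nonneg_left ?_ (inv_nonneg.2 hR.le)
          exact sum_le_sum_of_subset_of_nonneg (filter_subset _ _) fun x hx _ => mul_nonneg (hr x hx) (norm_nonneg _)
  linarith

/-! ## §2 Tuples all of whose entries are near -/

/-- **`#{x : Fin m → α | ∀ i, p (x i)} ≤ (#{y | p y})^m`** (the tuples form the product finset). -/
theorem card_filter_forall_le_pow {α : Type*} [Fintype α] [DecidableEq α] (m : ℕ) (p : α → Prop) [DecidablePred p] :
    ((univ : Finset (Fin m → α)).filter fun x => ∀ i, p (x i)).card ≤ ((univ : Finset α).filter p).card ^ m := by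
  have hsub : ((univ : Finset (Fin m → α)).filter fun x => ∀ i, p (x i)) ⊆ Fintype.piFinset fun _ : Fin m => (univ : Finset α).filter p := by
    intro x hx
    rw [Fintype.mem_piFinset]
    intro i
    exact mem_filter.2 ⟨mem_univ _, (mem_filter.1 hx).2 i⟩
  refine (card_le_card hsub).trans ?_
  rw [Fintype.card_piFinset, prod_const, card_univ, Fintype.card_fin]

/-! ## §3 The near/far split of the fixed-tuple size -/

variable {L M : ℕ} [NeZero L] [NeZero M]

omit [NeZero M] in
/-- **NEAR/FAR for the fixed-tuple size** (route (M), (V1′) skeleton): for any kernel family `W`, tuple `Ω`, pinned point `x₁` and radius `R > 0`, with `‖W_Ω(x₁ :: x)‖ ≤ B` for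
every free-leg tuple `x`, each first moment `ε^m·Σ_x spaceTimeDist(x₁, x_i)·‖W_Ω(x₁ :: x)‖ ≤ Mom` (`i < m`), and at most `N_R` space-time points within distance `R` of `x₁`:
`fixedTupleL1 β m W Ω x₁ ≤ ε^m·N_R^m·B + m·Mom/R`. -/
theorem fixedTupleL1_le_near_add_far {Ns m : ℕ} {β : ℝ} (hβ : 0 ≤ β)
    (W : (Fin (m + 1) → SectorLeg Ns) → (Fin (m + 1) → SpaceTimeIdx L M) → ℂ) (Ω : Fin (m + 1) → SectorLeg Ns) (x₁ : SpaceTimeIdx L M)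
    {R B Mom NR : ℝ} (hR : 0 < R) (hB0 : 0 ≤ B)
    (hB : ∀ x : Fin m → SpaceTimeIdx L M, ‖W Ω (Matrix.vecCons x₁ x)‖ ≤ B)
    (hMom : ∀ i : Fin m, imagTimeWeight β M ^ m *
      ∑ x : Fin m → SpaceTimeIdx L M, spaceTimeDist L M β x₁ (x i) * ‖W Ω (Matrix.vecCons x₁ x)‖ ≤ Mom)
    (hN : ((((univ : Finset (SpaceTimeIdx L M)).filter fun y => spaceTimeDist L M β x₁ y < R).card : ℕ) : ℝ) ≤ NR) :
    fixedTupleL1 L M β m W Ω x₁ ≤ imagTimeWeight β M ^ m * NR ^ m * B + m * Mom / R := by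
  have hε : 0 ≤ imagTimeWeight β M := imagTimeWeight_nonneg hβ M
  have hNR0 : 0 ≤ NR := le_trans (Nat.cast_nonneg _) hN
  -- the radius: the largest distance of a free leg to the pinned one (`0` if there is no free leg)
  set r : (Fin m → SpaceTimeIdx L M) → ℝ := fun x => ∑ i : Fin m, spaceTimeDist L M β x₁ (x i) with hr
  have hd0 : ∀ (x : Fin m → SpaceTimeIdx L M) (i : Fin m), 0 ≤ spaceTimeDist L M β x₁ (x i) := by
    intro x i
    unfold KLRegimeSplit.spaceTimeDist
    exact le_max_of_le_right (le_max_of_le_left (Nat.cast_nonneg _))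
  have hr0 : ∀ x, 0 ≤ r x := fun x => sum_nonneg fun i _ => hd0 x i
  -- the split
  have hsplit := sum_norm_le_near_add_far (univ : Finset (Fin m → SpaceTimeIdx L M)) (fun x => W Ω (Matrix.vecCons x₁ x)) r
    (fun x _ => hr0 x) hR (fun x _ => hB x)
  -- near count: `r x < R` forces every leg within distance `R`
  have hnear : ((((univ : Finset (Fin m → SpaceTimeIdx L M)).filter fun x => r x < R).card : ℕ) : ℝ) ≤ NR ^ m := by
    have h1 : ((univ : Finset (Fin m → SpaceTimeIdx L M)).filter fun x => r x < R) ⊆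
        ((univ : Finset (Fin m → SpaceTimeIdx L M)).filter fun x => ∀ i, spaceTimeDist L M β x₁ (x i) < R) := by
      intro x hx
      rw [mem_filter] at hx ⊢
      refine ⟨hx.1, fun i => lt_of_le_of_lt ?_ hx.2⟩
      exact single_le_sum (f := fun i => spaceTimeDist L M β x₁ (x i)) (fun j _ => hd0 x j) (mem_univ i)
    calc ((((univ : Finset (Fin m → SpaceTimeIdx L M)).filter fun x => r x < R).card : ℕ) : ℝ)
        ≤ ((((univ : Finset (Fin m → SpaceTimeIdx L M)).filter fun x => ∀ i, spaceTimeDist L M β x₁ (x i) < R).card : ℕ) : ℝ) := by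
          exact_mod_cast card_le_card h1
      _ ≤ ((((univ : Finset (SpaceTimeIdx L M)).filter fun y => spaceTimeDist L M β x₁ y < R).card ^ m : ℕ) : ℝ) := by
          exact_mod_cast card_filter_forall_le_pow m (fun y => spaceTimeDist L M β x₁ y < R)
      _ ≤ NR ^ m := by push_cast; exact pow_le_pow_left₀ (Nat.cast_nonneg _) hN m
  -- far part: the sum of the `m` first moments
  have hfar : imagTimeWeight β M ^ m * ∑ x : Fin m → SpaceTimeIdx L M, r x * ‖W Ω (Matrix.vecCons x₁ x)‖ ≤ m * Mom := by
    have h1 : ∑ x : Fin m → SpaceTimeIdx L M, r x * ‖W Ω (Matrix.vecCons x₁ x)‖ =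
        ∑ i : Fin m, ∑ x : Fin m → SpaceTimeIdx L M, spaceTimeDist L M β x₁ (x i) * ‖W Ω (Matrix.vecCons x₁ x)‖ := by
      rw [sum_comm]
      refine sum_congr rfl fun x _ => ?_
      rw [hr, sum_mul]
    rw [h1, mul_sum]
    calc ∑ i : Fin m, imagTimeWeight β M ^ m * ∑ x : Fin m → SpaceTimeIdx L M, spaceTimeDist L M β x₁ (x i) * ‖W Ω (Matrix.vecCons x₁ x)‖
        ≤ ∑ _i : Fin m, Mom := sum_le_sum fun i _ => hMom i
      _ = m * Mom := by rw [sum_const, card_univ, Fintype.card_fin, nsmul_eq_mul]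
  -- assemble
  unfold fixedTupleL1
  have hεm : 0 ≤ imagTimeWeight β M ^ m := pow_nonneg hε m
  calc imagTimeWeight β M ^ m * ∑ x : Fin m → SpaceTimeIdx L M, ‖W Ω (Matrix.vecCons x₁ x)‖
      ≤ imagTimeWeight β M ^ m * ((((univ : Finset (Fin m → SpaceTimeIdx L M)).filter fun x => r x < R).card : ℝ) * B +
          R⁻¹ * ∑ x : Fin m → SpaceTimeIdx L M, r x * ‖W Ω (Matrix.vecCons x₁ x)‖) := mul_le_mul_of_nonneg_left hsplit hεm
    _ = imagTimeWeight β M ^ m * (((univ : Finset (Fin m → SpaceTimeIdx L M)).filter fun x => r x < R).card : ℝ) * B +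
          R⁻¹ * (imagTimeWeight β M ^ m * ∑ x : Fin m → SpaceTimeIdx L M, r x * ‖W Ω (Matrix.vecCons x₁ x)‖) := by ring
    _ ≤ imagTimeWeight β M ^ m * NR ^ m * B + R⁻¹ * (m * Mom) := by
          gcongr
    _ = imagTimeWeight β M ^ m * NR ^ m * B + m * Mom / R := by rw [div_eq_inv_mul]

/-! ## §4 The split for sectorised kernels (sup by momentum data: `norm_sectorisedKernel_le`) -/

omit [NeZero M] in
/-- **NEAR/FAR for a sectorised kernel**: with `B_F := Σ_k (∏_i ‖F_{Ω_i}(k_i)‖)·‖kernel G (m+1) k‖` (the x-independent sup, `norm_sectorisedKernel_le`), the `m` first moments `≤ Mom` and the near count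
`≤ N_R`: `fixedTupleL1 β m (sectorisedKernel β F G (m+1)) Ω x₁ ≤ ε^m·N_R^m·B_F + m·Mom/R` — the near part reads only momentum masses of the multipliers and momentum VALUES of
the kernel (route (M): (E5-F)'s value hypothesis), the far part only the per-tuple first moment ((E4-iso)ₙ). -/
theorem fixedTupleL1_sectorisedKernel_le_near_add_far {N m : ℕ} {β : ℝ} (hβ : 0 ≤ β) (F : Fin N → FreqMomentum L M → ℂ) (G : HubbardGrassmann L M)
    (Ω : Fin (m + 1) → SectorLeg N) (x₁ : SpaceTimeIdx L M) {R Mom NR : ℝ} (hR : 0 < R)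
    (hMom : ∀ i : Fin m, imagTimeWeight β M ^ m *
      ∑ x : Fin m → SpaceTimeIdx L M, spaceTimeDist L M β x₁ (x i) * ‖sectorisedKernel L M β F G (m + 1) Ω (Matrix.vecCons x₁ x)‖ ≤ Mom)
    (hN : ((((univ : Finset (SpaceTimeIdx L M)).filter fun y => spaceTimeDist L M β x₁ y < R).card : ℕ) : ℝ) ≤ NR) :
    fixedTupleL1 L M β m (sectorisedKernel L M β F G (m + 1)) Ω x₁ ≤
      imagTimeWeight β M ^ m * NR ^ m *
          (∑ k : Fin (m + 1) → FreqMomentum L M, (∏ i, ‖F (Ω i).1.1 (k i)‖) * ‖kernel ℂ G (m + 1) (fun i => ((k i, (Ω i).1.2), (Ω i).2))‖) +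
        m * Mom / R :=
  fixedTupleL1_le_near_add_far hβ (sectorisedKernel L M β F G (m + 1)) Ω x₁ hR
    (sum_nonneg fun _ _ => mul_nonneg (prod_nonneg fun _ _ => norm_nonneg _) (norm_nonneg _))
    (fun _ => norm_sectorisedKernel_le β F G (m + 1) Ω _) hMom hN

end Summit.HubbardSuperconductivity.HubbardSuperconductivity.Theorems.EngineV8

end
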